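import Literature.MathematicalPhysics.QuantumManyBody.PeriodicBoseGasFracEnergy
import Mathlib.Analysis.InnerProductSpace.PiL2
import HarnessLib

/-!
# Route BECConjugateDomination — helpers for `NearMinimiserStability` (item stmt-AtomisticToContinuum-11788)

Support file (does not close the item) for the conditional proof of
`Summit.AtomisticToContinuum.BoseEinsteinCondensation.Theses.BECConjugateDomination.NearMinimiserStability`
in `BECConjugateDominationNearMinimiserStability.lean`. Two groups of elementary lemmas over the
periodic Bose gas vocabulary of `Literature/MathematicalPhysics/QuantumManyBody/PeriodicBoseGas.lean`:

* **Bounded periodised potentials.** A bounded finite-range profile `v` has a bounded periodisation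
  `v^per = ∑_{n∈ℤ³} v(|· - Ln|)` (`exists_bound_periodizedPotential`: at most `(⌈2R/L⌉+1)³` lattice
  points contribute), the smooth-class hypotheses (`v < ∞` pointwise, `x ↦ v(|x|)` continuous, finite
  range) give such a bound (`exists_bound_of_continuous_finiteRange`,
  `exists_bound_periodizedPotential_of_space`), and then `W = ∑_{i<j} v^per(xᵢ-xⱼ) ∈ L¹(cell)`
  (`lintegral_periodicInteraction_ne_top`), the hypothesis of the form-domain spectral theory
  `PeriodicFormSpectrum`.
* **The condensate occupation is `2N`-Lipschitz on the unit sphere of `L²(cell)`**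
  (`condensateOccupation_le_of_sub_le`): through slices
  `n₀(f) = N L⁻³ ∫_{cell^{N-1}} |∫_cell f(x,Y) dx|² dY` (`condensateOccupation_succ`), Peter–Paul
  `|a+b|² ≤ (1+t)|a|² + (1+t⁻¹)|b|²` and Cauchy–Schwarz on the cell,
  `n₀(f) ≤ n₀(g) + N(2η + η²)` whenever `∫_cell |f-g|² ≤ η²` and `∫_cell |g|² ≤ 1`; and the phase
  invariance `n₀(cf) = |c|² n₀(f)` (`condensateOccupation_const_mul`).
-/

noncomputable section

open MeasureTheory Filter Set Complex
open scoped ENNReal NNReal Topology ComplexConjugate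

namespace Summit.AtomisticToContinuum.BoseEinsteinCondensation.Theorems

open Literature.MathematicalPhysics.QuantumManyBody.BoseGas

/-! ### Bounded periodised potentials -/

section Potential

/-- A coordinate is bounded by the Euclidean norm: `|y k| ≤ ‖y‖` on `ℝ³`. [folklore] -/
theorem abs_apply_le_norm_space (y : Space) (k : Fin 3) : |y k| ≤ ‖y‖ := by
  have := PiLp.norm_apply_le y k
  simpa using this

/-- **A bounded finite-range profile has a bounded periodisation.** If `v ≤ M` and `v(r) = 0` for
`r > R₀`, then `v^per(x) = ∑_{n ∈ ℤ³} v(|x - Ln|)` has at most `(⌈2R/L⌉ + 1)³` non-zero terms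
(`R = max R₀ 0`), so `v^per ≤ M (⌈2R/L⌉ + 1)³`. [folklore] -/
theorem exists_bound_periodizedPotential {v : ℝ → ℝ≥0∞} {L : ℝ} (hL : 0 < L) {M : ℝ≥0}
    (hM : ∀ r, v r ≤ M) {R₀ : ℝ} (hR₀ : ∀ r, R₀ < r → v r = 0) :
    ∃ C : ℝ≥0, ∀ x, periodizedPotential v L x ≤ C := by
  set R : ℝ := max R₀ 0 with hR
  have hR0 : 0 ≤ R := le_max_right _ _
  set K : ℕ := ⌈2 * R / L⌉₊ + 1 with hK
  refine ⟨(K : ℝ≥0) ^ 3 * M, fun x => ?_⟩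
  set S : Finset (Fin 3 → ℤ) :=
    Fintype.piFinset fun k => Finset.Icc ⌈(x k - R) / L⌉ ⌊(x k + R) / L⌋ with hS
  -- terms off the box vanish
  have hsupp : ∀ n ∉ S, v ‖x - latticeVec L n‖ = 0 := by
    intro n hn
    rw [hS, Fintype.mem_piFinset] at hn
    push Not at hn
    obtain ⟨k, hk⟩ := hn
    rw [Finset.mem_Icc, not_and_or, not_le, not_le] at hk
    apply hR₀
    have hcoord : |x k - L * n k| ≤ ‖x - latticeVec L n‖ := by
      have := abs_apply_le_norm_space (x - latticeVec L n) k
      simpa [latticeVec] using this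
    refine lt_of_lt_of_le ?_ hcoord
    refine lt_of_le_of_lt (le_max_left R₀ 0) ?_
    rcases hk with hk | hk
    · -- `n k < ⌈(x k - R)/L⌉`, i.e. `L n k < x k - R`
      have h1 : ((n k : ℤ) : ℝ) < (x k - R) / L := Int.lt_ceil.1 hk
      rw [lt_div_iff₀ hL] at h1
      rw [lt_abs]; left; linarith
    · -- `⌊(x k + R)/L⌋ < n k`, i.e. `x k + R < L n k`
      have h1 : (x k + R) / L < ((n k : ℤ) : ℝ) := Int.floor_lt.1 hk
      rw [div_lt_iff₀ hL] at h1
      rw [lt_abs]; right; linarith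
  -- the box has at most `K³` points
  have hcard : S.card ≤ K ^ 3 := by
    rw [hS, Fintype.card_piFinset, ← Fin.prod_const]
    refine Finset.prod_le_prod' fun k _ => ?_
    rw [Int.card_Icc]
    refine (Int.toNat_le).2 ?_
    have h1 : ((⌊(x k + R) / L⌋ : ℤ) : ℝ) ≤ (x k + R) / L := Int.floor_le _
    have h2 : (x k - R) / L ≤ ((⌈(x k - R) / L⌉ : ℤ) : ℝ) := Int.le_ceil _
    have h3 : (2 * R / L : ℝ) ≤ (⌈2 * R / L⌉₊ : ℕ) := Nat.le_ceil _
    have h4 : ((⌊(x k + R) / L⌋ - ⌈(x k - R) / L⌉ : ℤ) : ℝ) ≤ ((⌈2 * R / L⌉₊ : ℕ) : ℝ) := by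
      push_cast
      have : (x k + R) / L - (x k - R) / L = 2 * R / L := by field_simp; ring
      linarith
    have h5 : (⌊(x k + R) / L⌋ - ⌈(x k - R) / L⌉ : ℤ) ≤ ((⌈2 * R / L⌉₊ : ℕ) : ℤ) := by
      exact_mod_cast h4
    rw [hK]; push_cast; linarith
  unfold periodizedPotential
  rw [tsum_eq_sum (s := S) fun n hn => hsupp n hn]
  calc ∑ n ∈ S, v ‖x - latticeVec L n‖ ≤ ∑ _n ∈ S, (M : ℝ≥0∞) := Finset.sum_le_sum fun n _ => hM _
    _ = (S.card : ℝ≥0∞) * M := by rw [Finset.sum_const, nsmul_eq_mul]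
    _ ≤ ((K ^ 3 : ℕ) : ℝ≥0∞) * M := by gcongr
    _ = (((K : ℝ≥0) ^ 3 * M : ℝ≥0) : ℝ≥0∞) := by push_cast; ring

/-- A bounded periodised potential gives an interaction `W = ∑_{i<j} v^per(xᵢ - xⱼ) ≤ N²C`, hence
`W ∈ L¹` of the cell. [folklore] -/
theorem lintegral_periodicInteraction_ne_top {v : ℝ → ℝ≥0∞} {L : ℝ} {C : ℝ≥0}
    (hC : ∀ x, periodizedPotential v L x ≤ C) (N : ℕ) :
    ∫⁻ X in cellN N L, periodicInteraction v L X ≠ ⊤ := by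
  have hpt : ∀ X : Config N, periodicInteraction v L X ≤ (N : ℝ≥0∞) * ((N : ℝ≥0∞) * C) := by
    intro X
    unfold periodicInteraction
    calc ∑ i : Fin N, ∑ j ∈ Finset.univ.filter (fun j : Fin N => i < j), periodizedPotential v L (X i - X j)
        ≤ ∑ _i : Fin N, ∑ _j : Fin N, (C : ℝ≥0∞) :=
          Finset.sum_le_sum fun i _ => (Finset.sum_le_sum_of_subset_of_nonneg (Finset.filter_subset _ _)
            (fun _ _ _ => bot_le)).trans (Finset.sum_le_sum fun j _ => hC _)
      _ = (N : ℝ≥0∞) * ((N : ℝ≥0∞) * C) := by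
          simp only [Finset.sum_const, Finset.card_univ, Fintype.card_fin, nsmul_eq_mul]
  refine ne_top_of_le_ne_top ?_ (lintegral_mono fun X => hpt X)
  rw [setLIntegral_const, volume_cellN]
  exact ENNReal.mul_ne_top (ENNReal.mul_ne_top (ENNReal.natCast_ne_top _)
    (ENNReal.mul_ne_top (ENNReal.natCast_ne_top _) ENNReal.coe_ne_top))
    (ENNReal.pow_ne_top (ENNReal.pow_ne_top ENNReal.ofReal_ne_top))

/-- **The smooth-class potentials are bounded**: if `v(r) < ∞` for all `r`, `x ↦ v(|x|)` is
continuous (as a real function) on `ℝ³` and `v` has finite range, then `v(|x|) ≤ M` for all `x`.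
[folklore] -/
theorem exists_bound_of_continuous_finiteRange {v : ℝ → ℝ≥0∞} (hfin : ∀ r, v r ≠ ⊤)
    (hcont : Continuous fun x : Space => (v ‖x‖).toReal) {R₀ : ℝ} (hR₀ : ∀ r, R₀ < r → v r = 0) :
    ∃ M : ℝ≥0, ∀ x : Space, v ‖x‖ ≤ M := by
  obtain ⟨B, hB⟩ := (isCompact_closedBall (0 : Space) (max R₀ 0)).exists_bound_of_continuousOn
    hcont.continuousOn
  refine ⟨(max B 0).toNNReal, fun x => ?_⟩
  change v ‖x‖ ≤ ENNReal.ofReal (max B 0)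
  by_cases hx : ‖x‖ ≤ max R₀ 0
  · have h := hB x (by simpa using hx)
    rw [Real.norm_of_nonneg ENNReal.toReal_nonneg] at h
    rw [← ENNReal.ofReal_toReal (hfin ‖x‖)]
    exact ENNReal.ofReal_le_ofReal (h.trans (le_max_left B 0))
  · rw [hR₀ _ ((le_max_left R₀ 0).trans_lt (not_le.1 hx))]
    exact bot_le

/-- Boundedness on `ℝ³` gives boundedness of the profile on `[0, ∞)`, which is all that
`periodizedPotential` evaluates. We record it as a bound on a modified profile agreeing with `v`
on the nonnegative reals: `v^per = ṽ^per` with `ṽ = v ∘ |·|`. [folklore] -/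
theorem exists_bound_periodizedPotential_of_space {v : ℝ → ℝ≥0∞} {L : ℝ} (hL : 0 < L) {M : ℝ≥0}
    (hM : ∀ x : Space, v ‖x‖ ≤ M) {R₀ : ℝ} (hR₀ : ∀ r, R₀ < r → v r = 0) :
    ∃ C : ℝ≥0, ∀ x, periodizedPotential v L x ≤ C := by
  -- the profile `w r = v |r|` is bounded everywhere and has the same periodisation
  set w : ℝ → ℝ≥0∞ := fun r => v |r| with hw
  have hwM : ∀ r, w r ≤ M := fun r => by
    have h := hM (EuclideanSpace.single 0 r)
    have hn : ‖EuclideanSpace.single (0 : Fin 3) r‖ = |r| := by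
      rw [EuclideanSpace.norm_eq]
      simp [Real.sqrt_sq_eq_abs]
    rwa [hn] at h
  have hwR : ∀ r, R₀ < r → w r = 0 := fun r hr => by
    rw [hw]
    exact hR₀ _ (hr.trans_le (le_abs_self r))
  obtain ⟨C, hC⟩ := exists_bound_periodizedPotential hL hwM hwR
  refine ⟨C, fun x => ?_⟩
  have : periodizedPotential v L x = periodizedPotential w L x := by
    unfold periodizedPotential
    simp only [hw, abs_norm]
  rw [this]
  exact hC x

end Potential

/-! ### The condensate occupation is Lipschitz on the unit sphere of `L²(cell)` -/

section Occupation

variable {n : ℕ} {L : ℝ}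

/-- **Cauchy–Schwarz against the constant function**: `‖∫ f dμ‖² ≤ μ(univ) ∫ ‖f‖² dμ`
(Hölder `2, 2`; no integrability needed). [folklore] -/
theorem nnnorm_integral_sq_le_mul_lintegral' {α : Type*} [MeasurableSpace α] (μ : Measure α)
    {f : α → ℂ} (hf : AEMeasurable f μ) :
    (‖∫ x, f x ∂μ‖₊ : ℝ≥0∞) ^ 2 ≤ μ Set.univ * ∫⁻ x, (‖f x‖₊ : ℝ≥0∞) ^ 2 ∂μ := by
  -- adapted from Literature/MathematicalPhysics/QuantumManyBody/DyadicCoherentFractionRefinement.lean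
  have hmeas : AEMeasurable (fun x => (‖f x‖₊ : ℝ≥0∞)) μ := hf.nnnorm.coe_nnreal_ennreal
  have h := ENNReal.lintegral_mul_le_Lp_mul_Lq μ Real.HolderConjugate.two_two hmeas
    (g := fun _ => 1) aemeasurable_const
  simp only [Pi.mul_apply, mul_one, lintegral_const, ENNReal.rpow_two, one_pow, one_mul] at h
  calc (‖∫ x, f x ∂μ‖₊ : ℝ≥0∞) ^ 2 ≤ (∫⁻ x, (‖f x‖₊ : ℝ≥0∞) ∂μ) ^ 2 := by
        gcongr; exact enorm_integral_le_lintegral_enorm _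
    _ ≤ ((∫⁻ x, (‖f x‖₊ : ℝ≥0∞) ^ 2 ∂μ) ^ (1 / 2 : ℝ) * μ Set.univ ^ (1 / 2 : ℝ)) ^ 2 := by gcongr
    _ = μ Set.univ * ∫⁻ x, (‖f x‖₊ : ℝ≥0∞) ^ 2 ∂μ := by
        rw [← ENNReal.mul_rpow_of_nonneg _ _ (by norm_num : (0 : ℝ) ≤ 1 / 2), ← ENNReal.rpow_two,
          ← ENNReal.rpow_mul]
        norm_num [mul_comm]

/-- The squared slice integral `Y ↦ |∫_cell k(x, Y) dx|²` of a continuous function is measurable.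
[folklore] -/
theorem measurable_sliceIntegral_sq (L : ℝ) {k : Config (n + 1) → ℂ} (hk : Continuous k) :
    Measurable fun Y : Config n => (‖∫ x in cell L, k (Matrix.vecCons x Y)‖₊ : ℝ≥0∞) ^ 2 := by
  have h : StronglyMeasurable
      (Function.uncurry fun (Y : Config n) (x : Space) => k (Matrix.vecCons x Y)) := by
    refine (hk.comp ?_).stronglyMeasurable
    exact continuous_snd.matrixVecCons continuous_fst
  exact ((h.integral_prod_right'
    (ν := volume.restrict (cell L))).measurable.nnnorm.coe_nnreal_ennreal).pow_const _

/-- **Slices are contracted by the constant-mode projection**: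
`L⁻³ ∫_{cell^n} |∫_cell k(x,Y) dx|² dY ≤ ∫_{cell^{n+1}} |k|²` (Cauchy–Schwarz on the cell and
Tonelli). [folklore] -/
theorem inv_mul_lintegral_sliceIntegral_sq_le (hL : 0 < L) {k : Config (n + 1) → ℂ}
    (hk : Continuous k) :
    (ENNReal.ofReal L ^ 3)⁻¹ *
        ∫⁻ Y in cellN n L, (‖∫ x in cell L, k (Matrix.vecCons x Y)‖₊ : ℝ≥0∞) ^ 2 ≤
      ∫⁻ X in cellN (n + 1) L, (‖k X‖₊ : ℝ≥0∞) ^ 2 := by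
  have hL3 : ENNReal.ofReal L ^ 3 ≠ 0 := pow_ne_zero _ (by simpa using hL)
  have hL3' : ENNReal.ofReal L ^ 3 ≠ ⊤ := ENNReal.pow_ne_top ENNReal.ofReal_ne_top
  rw [lintegral_cellN_succ L (F := fun X => (‖k X‖₊ : ℝ≥0∞) ^ 2)
      (hk.measurable.nnnorm.coe_nnreal_ennreal.pow_const _),
    ← lintegral_const_mul' _ _ (ENNReal.inv_ne_top.2 hL3)]
  refine lintegral_mono fun Y => ?_
  have hcont : Continuous fun x : Space => k (Matrix.vecCons x Y) :=
    hk.comp (continuous_id.matrixVecCons continuous_const)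
  have hcs := nnnorm_integral_sq_le_mul_lintegral' (volume.restrict (cell L))
    (f := fun x => k (Matrix.vecCons x Y)) hcont.measurable.aemeasurable
  rw [Measure.restrict_apply_univ, volume_cell] at hcs
  calc (ENNReal.ofReal L ^ 3)⁻¹ * (‖∫ x in cell L, k (Matrix.vecCons x Y)‖₊ : ℝ≥0∞) ^ 2
      ≤ (ENNReal.ofReal L ^ 3)⁻¹ *
          (ENNReal.ofReal L ^ 3 * ∫⁻ x in cell L, (‖k (Matrix.vecCons x Y)‖₊ : ℝ≥0∞) ^ 2) :=
        by gcongr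
    _ = ∫⁻ x in cell L, (‖k (Matrix.vecCons x Y)‖₊ : ℝ≥0∞) ^ 2 := by
        rw [← mul_assoc, ENNReal.inv_mul_cancel hL3 hL3', one_mul]

/-- **Peter–Paul** in `ℝ≥0∞`: `|a + b|² ≤ (1 + t)|a|² + (1 + t⁻¹)|b|²` for `t > 0`. [folklore] -/
theorem coe_nnnorm_add_sq_le (a b : ℂ) {t : ℝ} (ht : 0 < t) :
    ((‖a + b‖₊ : ℝ≥0∞)) ^ 2 ≤
      ENNReal.ofReal (1 + t) * (‖a‖₊ : ℝ≥0∞) ^ 2 + ENNReal.ofReal (1 + t⁻¹) * (‖b‖₊ : ℝ≥0∞) ^ 2 := by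
  have hreal : ‖a + b‖ ^ 2 ≤ (1 + t) * ‖a‖ ^ 2 + (1 + t⁻¹) * ‖b‖ ^ 2 := by
    have h2 : ‖a + b‖ ^ 2 ≤ (‖a‖ + ‖b‖) ^ 2 := pow_le_pow_left₀ (norm_nonneg _) (norm_add_le a b) 2
    have h3 : 0 ≤ t * ‖a‖ ^ 2 + t⁻¹ * ‖b‖ ^ 2 - 2 * ‖a‖ * ‖b‖ := by
      have key : t * (t * ‖a‖ ^ 2 + t⁻¹ * ‖b‖ ^ 2 - 2 * ‖a‖ * ‖b‖) = (t * ‖a‖ - ‖b‖) ^ 2 := by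
        field_simp
        ring
      have : 0 ≤ t * (t * ‖a‖ ^ 2 + t⁻¹ * ‖b‖ ^ 2 - 2 * ‖a‖ * ‖b‖) := by rw [key]; positivity
      exact (mul_nonneg_iff_of_pos_left ht).1 this
    nlinarith
  calc ((‖a + b‖₊ : ℝ≥0∞)) ^ 2 = ENNReal.ofReal (‖a + b‖ ^ 2) := coe_nnnorm_sq_eq_ofReal _
    _ ≤ ENNReal.ofReal ((1 + t) * ‖a‖ ^ 2 + (1 + t⁻¹) * ‖b‖ ^ 2) := ENNReal.ofReal_le_ofReal hreal
    _ = ENNReal.ofReal (1 + t) * (‖a‖₊ : ℝ≥0∞) ^ 2 +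
          ENNReal.ofReal (1 + t⁻¹) * (‖b‖₊ : ℝ≥0∞) ^ 2 := by
        rw [ENNReal.ofReal_add (by positivity) (by positivity), ENNReal.ofReal_mul (by positivity),
          ENNReal.ofReal_mul (by positivity), coe_nnnorm_sq_eq_ofReal, coe_nnnorm_sq_eq_ofReal]

/-- **The condensate occupation is `2N`-Lipschitz on the unit sphere of `L²(cell)`**
(quantitative form used for near-minimisers): for continuous `f, g` on `(ℝ³)^{n+1}` with
`∫_cell |g|² ≤ 1` and `∫_cell |f - g|² ≤ η²` (`η > 0`),
`⟨f, n₀ f⟩ ≤ ⟨g, n₀ g⟩ + (n+1)(2η + η²)`. Proof: through slices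
(`condensateOccupation_succ`), `|∫f|² ≤ (1+η)|∫g|² + (1+η⁻¹)|∫(f-g)|²` pointwise in `Y`, and the
slice functional is dominated by the cell norm (`inv_mul_lintegral_sliceIntegral_sq_le`).
[cite: LSSY2005, §1.2 (1.17)] -/
theorem condensateOccupation_le_of_sub_le (hL : 0 < L) {f g : Config (n + 1) → ℂ}
    (hf : Continuous f) (hg : Continuous g)
    (hg1 : ∫⁻ X in cellN (n + 1) L, (‖g X‖₊ : ℝ≥0∞) ^ 2 ≤ 1) {η : ℝ} (hη : 0 < η)
    (hfg : ∫⁻ X in cellN (n + 1) L, (‖f X - g X‖₊ : ℝ≥0∞) ^ 2 ≤ ENNReal.ofReal (η ^ 2)) :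
    condensateOccupation (n + 1) L f ≤
      condensateOccupation (n + 1) L g + ENNReal.ofReal (((n + 1 : ℕ) : ℝ) * (2 * η + η ^ 2)) := by
  rw [condensateOccupation_succ hL f, condensateOccupation_succ hL g]
  set h : Config (n + 1) → ℂ := fun X => f X - g X with hh
  have hhc : Continuous h := hf.sub hg
  set V : ℝ≥0∞ := (ENNReal.ofReal L ^ 3)⁻¹ with hV
  set Ig : Config n → ℝ≥0∞ := fun Y => (‖∫ x in cell L, g (Matrix.vecCons x Y)‖₊ : ℝ≥0∞) ^ 2
  set Ih : Config n → ℝ≥0∞ := fun Y => (‖∫ x in cell L, h (Matrix.vecCons x Y)‖₊ : ℝ≥0∞) ^ 2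
  -- pointwise splitting and Peter–Paul
  have hpt : ∀ Y : Config n, (‖∫ x in cell L, f (Matrix.vecCons x Y)‖₊ : ℝ≥0∞) ^ 2 ≤
      ENNReal.ofReal (1 + η) * Ig Y + ENNReal.ofReal (1 + η⁻¹) * Ih Y := by
    intro Y
    have hvc : Continuous fun x : Space => (Matrix.vecCons x Y : Config (n + 1)) :=
      continuous_id.matrixVecCons continuous_const
    have hsplit : ∫ x in cell L, f (Matrix.vecCons x Y) =
        (∫ x in cell L, g (Matrix.vecCons x Y)) + ∫ x in cell L, h (Matrix.vecCons x Y) := by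
      rw [← integral_add (integrableOn_cell (f := fun x => g (Matrix.vecCons x Y)) (hg.comp hvc))
        (integrableOn_cell (f := fun x => h (Matrix.vecCons x Y)) (hhc.comp hvc))]
      refine integral_congr_ae (Eventually.of_forall fun x => ?_)
      simp [hh]
    rw [hsplit]
    exact coe_nnnorm_add_sq_le _ _ hη
  -- integrate over `Y`
  have hIg : Measurable Ig := measurable_sliceIntegral_sq L hg
  have hint : (∫⁻ Y in cellN n L, (‖∫ x in cell L, f (Matrix.vecCons x Y)‖₊ : ℝ≥0∞) ^ 2) ≤
      ENNReal.ofReal (1 + η) * (∫⁻ Y in cellN n L, Ig Y) +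
        ENNReal.ofReal (1 + η⁻¹) * (∫⁻ Y in cellN n L, Ih Y) := by
    calc ∫⁻ Y in cellN n L, (‖∫ x in cell L, f (Matrix.vecCons x Y)‖₊ : ℝ≥0∞) ^ 2
        ≤ ∫⁻ Y in cellN n L, (ENNReal.ofReal (1 + η) * Ig Y + ENNReal.ofReal (1 + η⁻¹) * Ih Y) :=
          lintegral_mono fun Y => hpt Y
      _ = _ := by
          rw [lintegral_add_left (hIg.const_mul _), lintegral_const_mul _ hIg,
            lintegral_const_mul'' _ (measurable_sliceIntegral_sq L hhc).aemeasurable]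
  -- the two slice functionals
  have hAg : V * (∫⁻ Y in cellN n L, Ig Y) ≤ 1 :=
    (inv_mul_lintegral_sliceIntegral_sq_le hL hg).trans hg1
  have hAh : V * (∫⁻ Y in cellN n L, Ih Y) ≤ ENNReal.ofReal (η ^ 2) :=
    (inv_mul_lintegral_sliceIntegral_sq_le hL hhc).trans hfg
  -- bookkeeping
  have hη1 : ENNReal.ofReal (1 + η) = 1 + ENNReal.ofReal η := by
    rw [ENNReal.ofReal_add zero_le_one hη.le, ENNReal.ofReal_one]
  have herr : ENNReal.ofReal η * 1 + ENNReal.ofReal (1 + η⁻¹) * ENNReal.ofReal (η ^ 2) =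
      ENNReal.ofReal (2 * η + η ^ 2) := by
    rw [mul_one, ← ENNReal.ofReal_mul (by positivity), ← ENNReal.ofReal_add hη.le (by positivity)]
    congr 1
    field_simp
    ring
  calc ((n : ℝ≥0∞) + 1) * (V * ∫⁻ Y in cellN n L, (‖∫ x in cell L, f (Matrix.vecCons x Y)‖₊ : ℝ≥0∞) ^ 2)
      ≤ ((n : ℝ≥0∞) + 1) * (V * (ENNReal.ofReal (1 + η) * (∫⁻ Y in cellN n L, Ig Y) +
          ENNReal.ofReal (1 + η⁻¹) * (∫⁻ Y in cellN n L, Ih Y))) := by gcongr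
    _ = ((n : ℝ≥0∞) + 1) * (V * (∫⁻ Y in cellN n L, Ig Y)) +
          ((n : ℝ≥0∞) + 1) * (ENNReal.ofReal η * (V * (∫⁻ Y in cellN n L, Ig Y)) +
            ENNReal.ofReal (1 + η⁻¹) * (V * (∫⁻ Y in cellN n L, Ih Y))) := by
        rw [hη1]; ring
    _ ≤ ((n : ℝ≥0∞) + 1) * (V * (∫⁻ Y in cellN n L, Ig Y)) +
          ((n : ℝ≥0∞) + 1) * (ENNReal.ofReal η * 1 +
            ENNReal.ofReal (1 + η⁻¹) * ENNReal.ofReal (η ^ 2)) := by gcongr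
    _ = ((n : ℝ≥0∞) + 1) * (V * (∫⁻ Y in cellN n L, Ig Y)) +
          ENNReal.ofReal (((n + 1 : ℕ) : ℝ) * (2 * η + η ^ 2)) := by
        rw [herr, ENNReal.ofReal_mul (by positivity), ENNReal.ofReal_natCast]
        push_cast
        ring

/-- **Phase invariance of the condensate occupation**: `n₀(c f) = |c|² n₀(f)`. [folklore] -/
theorem condensateOccupation_const_mul (hL : 0 < L) (c : ℂ) (f : Config (n + 1) → ℂ) :
    condensateOccupation (n + 1) L (fun X => c * f X) =
      (‖c‖₊ : ℝ≥0∞) ^ 2 * condensateOccupation (n + 1) L f := by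
  rw [condensateOccupation_succ hL, condensateOccupation_succ hL f]
  have hpt : ∀ Y : Config n, (‖∫ x in cell L, c * f (Matrix.vecCons x Y)‖₊ : ℝ≥0∞) ^ 2 =
      (‖c‖₊ : ℝ≥0∞) ^ 2 * (‖∫ x in cell L, f (Matrix.vecCons x Y)‖₊ : ℝ≥0∞) ^ 2 := by
    intro Y
    rw [integral_const_mul, nnnorm_mul, ENNReal.coe_mul, mul_pow]
  simp only [hpt]
  rw [lintegral_const_mul' _ _ (ENNReal.pow_ne_top ENNReal.coe_ne_top)]
  ring

end Occupation

end Summit.AtomisticToContinuum.BoseEinsteinCondensation.Theorems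

end
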